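import Summits.Ventures.PercRepro.RankLevelSetUpFour

/-! # RankLevelSetUpNoTripleAll — (↑) AT EVERY LEVEL ON EVERY MATROID OF NULLITY `≤ 4` WITHOUT A SERIES TRIPLE
(night-1 g40; dossier §52.18; on `RankLevelSetUpFour`)

On a coloop-free matroid of nullity `≤ 4` without a series triple the chain gives (↑) at every level `k ≥ 4`
(`upAt_of_no_triple`), and every level `k ≤ 4` is `upAt_of_nullity_four`; a coloop is removed by `upAt_of_isColoop`
(levels `k` and `k − 1` of the deletion, which keeps the nullity bound and has no series triple either —
**`noSeriesTriple_delete_coloop`**: `(M ＼ c)✶ = M✶ ／ c = M✶ ＼ c` for the loop `c` of `M✶`, whose closures are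
those of `M✶` minus `c`) or, at `b = c`, by `upAt_self_of_isColoop` with Mono of the deletion
(`biIndepMono_of_nullity`). Hence **`upAt_of_nullity_four_of_noSeriesTriple`** and the class theorem
**`biIndepUp_of_nullity_four_of_noSeriesTriple`**: `BiIndepUp M` for every finite matroid of nullity `≤ 4` without a
series triple. Every declaration has a docstring; imports: the cell's own modules and Mathlib only.
Axioms: standard. -/

namespace PercRepro

open Set Matroid

variable {α : Type} (M : Matroid α) [M.Finite]

omit [M.Finite] in
/-- **Deleting a coloop creates no series triple**: `(M ＼ c)✶ = M✶ ＼ c` (the contraction of the loop `c` of `M✶`),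
whose closures are those of `M✶` minus `c`. -/
lemma noSeriesTriple_delete_coloop {c : α} (hc : M.IsColoop c) (hnt : NoSeriesTriple M) :
    NoSeriesTriple (M.delete {c}) := by
  intro p q r hpq hpr hqr hp hq hr
  have hloop : ({c} : Set α) ⊆ M✶.loops := by
    rw [Set.singleton_subset_iff, ← Matroid.isLoop_iff, Matroid.dual_isLoop_iff_isColoop]
    exact hc
  rw [Matroid.dual_delete, Matroid.contract_eq_delete_of_subset_loops hloop] at hp hq hr
  have hpc : p ∉ ({c} : Set α) := fun h => hp.mem_ground.2 h
  rw [Matroid.delete_closure_eq_of_disjoint M✶ (Set.disjoint_singleton_left.mpr hpc)] at hq hr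
  exact hnt p q r hpq hpr hqr (Matroid.delete_isNonloop_iff.mp hp).1 hq.1 hr.1

/-- **(↑) AT EVERY LEVEL ON EVERY MATROID OF NULLITY `≤ 4` WITHOUT A SERIES TRIPLE** (`2k + 2 ≤ #E`): strong
induction on `#E`, removing coloops; on a coloop-free matroid the levels `k ≤ 4` by `upAt_of_nullity_four` and the
levels `k ≥ 4` by the chain `upAt_of_no_triple`. -/
theorem upAt_of_nullity_four_of_noSeriesTriple :
    ∀ n : ℕ, ∀ (M' : Matroid α) [M'.Finite], M'.E.ncard = n → M'✶.eRank ≤ 4 → NoSeriesTriple M' →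
      ∀ k : ℕ, 2 * k + 2 ≤ n → ∀ b ∈ M'.E, BiIndepUpAt M' b k := by
  intro n
  induction n using Nat.strong_induction_on with
  | _ n ih =>
    intro M' _ hn hν hnt k hkn b hb
    by_cases hcol : ∃ c, M'.IsColoop c
    · obtain ⟨c, hc⟩ := hcol
      haveI := delete_finite' M' c
      have hcard : (M'.delete {c}).E.ncard = n - 1 := by
        rw [Matroid.delete_ground, Set.ncard_sdiff_singleton_of_mem hc.mem_ground, hn]
      have hν' : (M'.delete {c})✶.eRank ≤ 4 := (eRank_dual_delete_isColoop_le M' hc).trans hν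
      have hnt' : NoSeriesTriple (M'.delete {c}) := noSeriesTriple_delete_coloop M' hc hnt
      rcases Nat.lt_or_ge k 1 with hk0 | hk1
      · have : k = 0 := by omega
        subst this
        exact upAt_zero M' b
      obtain ⟨k', rfl⟩ : ∃ k', k = k' + 1 := ⟨k - 1, by omega⟩
      by_cases hbc : b = c
      · subst hbc
        exact upAt_self_of_isColoop M' hc (by omega) (biIndepMono_of_nullity (M'.delete {b}) hν')
      · have hbM : b ∈ (M'.delete {c}).E := by
          rw [Matroid.delete_ground]; exact ⟨hb, by simpa using hbc⟩
        refine upAt_of_isColoop M' hc hbc ?_ ?_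
        · rcases Nat.lt_or_ge (2 * (k' + 1) + 2) n with hlt | hge
          · exact ih (n - 1) (by omega) (M'.delete {c}) hcard hν' hnt' (k' + 1) (by omega) b hbM
          · rw [upAt_iff_through_le_through _ hbM (by omega), hcard]
            have e : n - 1 - 1 - (k' + 1) = k' + 1 := by omega
            rw [e]
        · exact ih (n - 1) (by omega) (M'.delete {c}) hcard hν' hnt' k' (by omega) b hbM
    · simp only [not_exists] at hcol
      rcases Nat.lt_or_ge k 4 with hk | hk
      · exact upAt_of_nullity_four n M' hn hν k (by omega) hkn b hb
      · exact upAt_of_no_triple M' hcol hν hnt hb hk (by omega)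

/-- **THE CLASS THEOREM: (↑) HOLDS ON EVERY FINITE MATROID OF NULLITY `≤ 4` WITHOUT A SERIES TRIPLE.** -/
theorem biIndepUp_of_nullity_four_of_noSeriesTriple (hν : M✶.eRank ≤ 4) (hnt : NoSeriesTriple M) :
    BiIndepUp M :=
  fun b hb k hk => upAt_of_nullity_four_of_noSeriesTriple M.E.ncard M rfl hν hnt k hk b hb

end PercRepro
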